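import Summits.QuantumFields.YangMills.Theorems.FluctuationComparisonRegPrIntLS2BetaCoarseGradientOfBkg
import Summits.QuantumFields.YangMills.Theorems.FluctuationComparisonRegPrIntLS2BetaLipschitzLift
import HarnessLib

/-!
# S2β · GAP♯∘ — (RES-u.7σ)⁺ «THE SMOOTH RESIDUAL COPY FROM THE LETTERS»: ONE NAME for the σ-side of «E_J-FACE» — from the small-bond gauge letter at level `K`
# (ARC currency), the (BKG) plaquette binder, the datum's √θ-gauge and ONE window inequality, a RESIDUAL copy of the minimiser IN THE ARGMIN SET with fine-small
# bonds EVERYWHERE: `dist1 ((r•U₀) b) ≤ s + 2π·τ_β·(L⁻¹)^{K−J}`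

Cell `ym3-torus` (rung R3 = continuum `SU(2)` YM₃ on T³ at fixed lattice data — NOT d = 4, NOT infinite volume, NOT a mass gap, NOT Clay).  Width seat
`ym-ust-20520-w5` (gen 29), explicit-unit helper on crux `stmt-QuantumFields-20520`, LINE g18-1 S2β (registry untouched), organ GAP♯∘, node (RES-u); desk RULING №131
(RES-u.7σ) «supply by name (i) `hBG`@K, (ii) the Lipschitz lift, (iii) the residual quotient».  COMPOSITION BY NAME of three landed files (px21 g26's dock twin D2, over the tree):
✓`…CoarseGradientOfBkg.bondGrad_descTransf_le_of_bkg_of_arc` (w5: the `hgrad` of the lift at `t := g↓`, `τ_β := (L^{K−J}·s + ((3+2)²L∕(2(L−1)))·C_B·α) + σ_V`) ⟶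
✓`…LipschitzLift.exists_lipschitzLift` (px21 g26, (RES-u.7): `∃ û, û↓ = g↓ ∧ fine gradient ≤ 2π·τ_β·(L⁻¹)^{K−J}`, window `τ_β ≤ 1∕8`) ⟶
✓`…SmoothResidualCopy.exists_smoothResidualCopy_mem_argmin_of_arc` (w5, (RES-u.7σ): `r := û⁻¹·g` residual, argmin kept, bonds `≤ s + γ`).
* ★★★`exists_smoothResidualCopy_of_letters` (argmin edition) and `exists_smoothResidualCopy_of_letters_fibre` (fibre-only edition).
`--kind proof --supports stmt-QuantumFields-20520 --as helper`, DEFINITION-FREE (0 `def`, 0 `instance`, 0 `sorry`; default heartbeats).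

HONEST.  Composition by name, zero mathematics of its own; the displayed letters `hgArc` (= the conjectured small-bond gauge letter `hBG` READ AT LEVEL `K`), `hBKG` (the lane's (BKG)
binder), `hσV` (√θ-gauge of the datum) and the window inequality `τ_β ≤ 1∕8` are HYPOTHESES; nothing of Bałaban's analysis is asserted or proved ([Balaban1985Averaging] (8) p.18,
(11)–(13) p.19; [Balaban1985Variational] (4) p.278, Thm 1 (8) p.279; [Balaban1985RegularSpaces] Thm 2 p.83); GAP♯∘ (`stub_uniformFibreGapOrbit`, 0∕5), the five REGISTERED stubs,
S2β, crux 20520, 19936, 19200, `YM3TorusSU2` NOT proved; no summit statement is proved by a helper; rung R3 = SU(2) YM₃ on T³ — NOT d = 4, NOT infinite volume, NOT a mass gap, NOT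
Clay; the Yang–Mills mass gap is NOT proved.
-/

set_option autoImplicit false

noncomputable section

namespace Summit.QuantumFields.YangMills.Theorems.FluctuationComparisonRegPrIntLS2BetaSmoothResidualCopyOfLetters

open Literature.MathematicalPhysics.QuantumLattice (su2Quat)
open Literature.MathematicalPhysics.QuantumFieldTheory.Balaban1983to89
open T4Continuum T3ContinuumYM3Torus T3UnitScaleTilt T3TiltDescent T3LevelShift
open T3UnitLawDensityEML (ℰp)
open T3ConstrainedMinimiser (fibre)
open T3PrintedRegularMinimiser (minActionRegPr)
open T3PrintedRegularOrbits (descTransf)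
open T4ExpWindowSmallField (logVec)
open ExpMeanLog (deltaSU)
open Summit.QuantumFields.YangMills.Theorems.FluctuationComparisonRegPrIntLS2BetaSmoothResidualCopy
  (exists_smoothResidualCopy_mem_argmin_of_arc exists_smoothResidualCopy)
open Summit.QuantumFields.YangMills.Theorems.FluctuationComparisonRegPrIntLS2BetaCoarseGradientOfBkg (bondGrad_descTransf_le_of_bkg_of_arc bondGrad_descTransf_le_of_bkg)
open Summit.QuantumFields.YangMills.Theorems.FluctuationComparisonRegPrIntLS2BetaLipschitzLift (exists_lipschitzLift)
open Summit.QuantumFields.YangMills.Theorems.FluctuationComparisonRegPrIntLS2BetaGeodesicJensenLift (dist1_le_norm_logVec)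

variable (F : T3Family) {J K : ℕ} (hJK : J ≤ K)

/-- ★★★ **THE SMOOTH RESIDUAL COPY FROM THE LETTERS** (argmin edition): `U₀` in the argmin set over `V` (GAP♯∘'s set text), a fine gauge `g` with ARCS of `g•U₀` `≤ s` (`hBG` read
at level `K`), the (BKG) plaquette binder for `U₀` (✓p840154's text) with its two window clauses, the datum's bonds `≤ σ_V`, and the window inequality
`τ_β := (L^{K−J}·s + ((3+2)²L∕(2(L−1)))·C_B·α) + σ_V ≤ 1∕8` ⟹ a RESIDUAL `r` with `r•U₀` in the SAME argmin set and `dist1 ((r•U₀) b) ≤ s + 2π·τ_β·(L⁻¹)^{K−J}` on EVERY fine bond.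
[cite: Balaban1985Averaging, (8) p.18, (11)-(13) p.19; Balaban1985Variational, Thm 1 (8) p.279, (4) p.278; Balaban1985RegularSpaces, Thm 2 p.83] -/
theorem exists_smoothResidualCopy_of_letters {γ' b₀ p₀ ε₀ : ℝ} {g : Site (F.P K) 0 → Matrix.specialUnitaryGroup (Fin 2) ℂ}
    {V : GaugeField (F.P J) 0 (Matrix.specialUnitaryGroup (Fin 2) ℂ)} {U₀ : GaugeField (F.P K) 0 (Matrix.specialUnitaryGroup (Fin 2) ℂ)}
    {s C_B α σV : ℝ}
    (hU₀ : U₀ ∈ {U' : GaugeField (F.P K) 0 (Matrix.specialUnitaryGroup (Fin 2) ℂ) | U' ∈ fibre F ℰp J K hJK V ∧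
      U' ∈ histGood F ℰp (θBal F.L γ' b₀ p₀) K J ∧ wilsonAction4 U' = minActionRegPr F J K hJK ε₀ V})
    (hgArc : ∀ e : PBond (F.P K) 0, ‖logVec (su2Quat (GaugeField.gaugeAct g U₀ e))‖ ≤ s) (hCB : 0 ≤ C_B) (hα : 0 ≤ α)
    (hBKG : ∀ t, t ≤ K - J → ∀ p : Plaq (F.P K) t,
      dist1 (GaugeField.plaqHol (Averaging.iter (fun k => BlockAveraging.blockAvg (P := F.P K) (j := k) ℰp) t U₀) p) ≤
        C_B * α * (F.L : ℝ) ^ (2 * t) * ((F.L : ℝ)⁻¹) ^ (2 * (K - J)))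
    (hδ : ((((3 + 2) * F.L : ℕ) : ℝ) ^ 2 / 4) * (C_B * α) < deltaSU (Fin 2))
    (h6 : ((((3 + 2) * F.L : ℕ) : ℝ) ^ 2 / 4) * (C_B * α) ≤ 1 / 6)
    (hσV : ∀ B : PBond (F.P J) 0, dist1 (V B) ≤ σV)
    (hτ0 : 0 ≤ ((F.L : ℝ) ^ (K - J) * s + ((3 + 2) ^ 2 * (F.L : ℝ) / (2 * ((F.L : ℝ) - 1))) * (C_B * α)) + σV)
    (hτ : ((F.L : ℝ) ^ (K - J) * s + ((3 + 2) ^ 2 * (F.L : ℝ) / (2 * ((F.L : ℝ) - 1))) * (C_B * α)) + σV ≤ 1 / 8) :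
    ∃ r : Site (F.P K) 0 → Matrix.specialUnitaryGroup (Fin 2) ℂ,
      (∀ U : GaugeField (F.P K) 0 (Matrix.specialUnitaryGroup (Fin 2) ℂ),
          descendTo F ℰp J K hJK (GaugeField.gaugeAct r U) = descendTo F ℰp J K hJK U) ∧
        GaugeField.gaugeAct r U₀ ∈ {U' : GaugeField (F.P K) 0 (Matrix.specialUnitaryGroup (Fin 2) ℂ) | U' ∈ fibre F ℰp J K hJK V ∧
          U' ∈ histGood F ℰp (θBal F.L γ' b₀ p₀) K J ∧ wilsonAction4 U' = minActionRegPr F J K hJK ε₀ V} ∧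
        ∀ b : PBond (F.P K) 0, dist1 (GaugeField.gaugeAct r U₀ b) ≤
          s + 2 * Real.pi * (((F.L : ℝ) ^ (K - J) * s + ((3 + 2) ^ 2 * (F.L : ℝ) / (2 * ((F.L : ℝ) - 1))) * (C_B * α)) + σV) * ((F.L : ℝ)⁻¹) ^ (K - J) :=
  exists_smoothResidualCopy_mem_argmin_of_arc F hJK hU₀ hgArc
    (exists_lipschitzLift F hJK (descTransf F J K hJK g) hτ0 hτ
      (bondGrad_descTransf_le_of_bkg_of_arc F hJK hU₀.1 hgArc hCB hα hBKG hδ h6 hσV))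

/-- FIBRE-ONLY EDITION (any `U₀` over `V`, `dist1`-currency small-bond letter): a RESIDUAL copy with `dist1 ((r•U₀) b) ≤ s + 2π·τ_β·(L⁻¹)^{K−J}` on every fine bond.
[cite: Balaban1985Averaging, (8) p.18, (11)-(13) p.19; Balaban1985Variational, (4) p.278] -/
theorem exists_smoothResidualCopy_of_letters_fibre {g : Site (F.P K) 0 → Matrix.specialUnitaryGroup (Fin 2) ℂ}
    {V : GaugeField (F.P J) 0 (Matrix.specialUnitaryGroup (Fin 2) ℂ)} {U₀ : GaugeField (F.P K) 0 (Matrix.specialUnitaryGroup (Fin 2) ℂ)}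
    {s C_B α σV : ℝ} (hU₀ : U₀ ∈ fibre F ℰp J K hJK V)
    (hg : ∀ ℓ : PBond (F.P K) 0, dist1 (GaugeField.gaugeAct g U₀ ℓ) ≤ s) (hCB : 0 ≤ C_B) (hα : 0 ≤ α)
    (hBKG : ∀ t, t ≤ K - J → ∀ p : Plaq (F.P K) t,
      dist1 (GaugeField.plaqHol (Averaging.iter (fun k => BlockAveraging.blockAvg (P := F.P K) (j := k) ℰp) t U₀) p) ≤
        C_B * α * (F.L : ℝ) ^ (2 * t) * ((F.L : ℝ)⁻¹) ^ (2 * (K - J)))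
    (hδ : ((((3 + 2) * F.L : ℕ) : ℝ) ^ 2 / 4) * (C_B * α) < deltaSU (Fin 2))
    (h6 : ((((3 + 2) * F.L : ℕ) : ℝ) ^ 2 / 4) * (C_B * α) ≤ 1 / 6)
    (hσV : ∀ B : PBond (F.P J) 0, dist1 (V B) ≤ σV)
    (hτ0 : 0 ≤ ((F.L : ℝ) ^ (K - J) * s + ((3 + 2) ^ 2 * (F.L : ℝ) / (2 * ((F.L : ℝ) - 1))) * (C_B * α)) + σV)
    (hτ : ((F.L : ℝ) ^ (K - J) * s + ((3 + 2) ^ 2 * (F.L : ℝ) / (2 * ((F.L : ℝ) - 1))) * (C_B * α)) + σV ≤ 1 / 8) :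
    ∃ r : Site (F.P K) 0 → Matrix.specialUnitaryGroup (Fin 2) ℂ,
      (∀ U : GaugeField (F.P K) 0 (Matrix.specialUnitaryGroup (Fin 2) ℂ),
          descendTo F ℰp J K hJK (GaugeField.gaugeAct r U) = descendTo F ℰp J K hJK U) ∧
        ∀ b : PBond (F.P K) 0, dist1 (GaugeField.gaugeAct r U₀ b) ≤
          s + 2 * Real.pi * (((F.L : ℝ) ^ (K - J) * s + ((3 + 2) ^ 2 * (F.L : ℝ) / (2 * ((F.L : ℝ) - 1))) * (C_B * α)) + σV) * ((F.L : ℝ)⁻¹) ^ (K - J) :=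
  exists_smoothResidualCopy F hJK hg
    (exists_lipschitzLift F hJK (descTransf F J K hJK g) hτ0 hτ
      (bondGrad_descTransf_le_of_bkg F hJK hU₀ hg hCB hα hBKG hδ h6 hσV))

end Summit.QuantumFields.YangMills.Theorems.FluctuationComparisonRegPrIntLS2BetaSmoothResidualCopyOfLetters

end
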